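import Summits.QuantumAdvantage.QuantumAdvantage.Theses.MobiusLadder
import Summits.QuantumAdvantage.QuantumAdvantage.Theorems.MobiusLadderLiouvilleNotPPolyStubTransfer
import Summits.QuantumAdvantage.QuantumAdvantage.Theorems.MobiusLadderLiouvilleNotPPolyStubSqfreeSign
import Summits.QuantumAdvantage.QuantumAdvantage.Theorems.MobiusLadderLiouvilleNotPPolyStubSplitAtT
import Summits.QuantumAdvantage.QuantumAdvantage.Theorems.MobiusLadderLiouvilleNotPPolyStubMultAtShift
import Summits.QuantumAdvantage.QuantumAdvantage.Theorems.MobiusLadderLiouvilleNotPPolyStubAssemble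
import Literature.NumberTheory.EllipticCurves.RootNumberAtkinLehnerSemistableProofs
import Literature.NumberTheory.EllipticCurves.BSDRootNumberLocalTablesProofs

/-!
# The apex of line `SketchIdeator2`, transparently: `AlgRootSignHard ↔ PairHard → LiouvilleNotPPoly`

Helper file for the crux `MobiusLadder.LiouvilleNotPPoly` (stmt-QuantumAdvantage-1389), line
`SketchIdeator2` (ROOT-NUMBER TRANSFER on the `X₁(3)` family `E_t : y² + x·y + t·y = x³`),
continuation lead c1, skeleton v5 (one registered stub, the apex
`stub_algRootSignHard : ¬ ∃ L ∈ P/poly, ∀ t ≥ 1, t(27t−1) squarefree → (bin t ∈ L ↔ −∏_p w_p(E_t) = −1)`).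
This file states what the apex IS, by accepted theorems only (stubs A B C1 C2 F, imported; the
pointwise identities `−∏_p w_p(E_t) = λ(t)λ(27t−1)` and, under M, `w(E_t) = λ(t)λ(27t−1)` on the
promise are those of `Theorems/MobiusLadderLiouvilleNotPPoly.lean`, re-derived inline in three lines):

* `algRootSign_promiseDecidable_iff_pairSign` — **`AlgRootSignHard ↔ PairHard`** unconditionally,
  where `PairHard` says that the Liouville PAIR SIGN `t ↦ λ(t)·λ(27t−1)` has no polynomial-size
  circuits on the squarefree promise (pointwise `−∏_p w_p(E_t) = λ(t)λ(27t−1)` there): the apex with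
  every elliptic-curve word removed;
* `rootSign_promiseDecidable_iff_algRootSign` — under the Modularity Theorem
  (`exists_isNewformOf`, named fact) the ANALYTIC apex of skeleton v4 (`w(E_t)`, the sign of the
  functional equation) and the algebraic apex of v5 coincide;
* `liouvilleNotPPoly_of_pairHard` — **`PairHard → LiouvilleNotPPoly`** (two `λ`-queries, stub A):
  the elementary bridge a promoted apex item can cite;
* `pairSign_mem_PPoly_of_not_liouvilleNotPPoly` — the refutation floor in elementary form.

So the one remaining hypothesis of the line is, in three equivalent costumes, "no polynomial-size
circuit family computes `λ(t)λ(27t−1)` / `−∏_p w_p(E_t)` / (under modularity) `w(E_t)` from `bin t`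
on a set of density `(8/7)∏_{p≠3}(1 − 2/p²) ≈ 0.368`" — hypothesis-type and crux-sized (it implies
the crux, which implies `NP ⊄ P/poly`, `Theorems/MobiusLadderLiouvilleNotPPolyStrength.lean`).
Theorems only; no definition is introduced.
-/

set_option linter.dupNamespace false -- D-0017: single-problem summit ⇒ `QuantumAdvantage.QuantumAdvantage` by design

noncomputable section

namespace Summit.QuantumAdvantage.QuantumAdvantage.Theorems.LiouvilleNotPPoly

open scoped Classical
open _root_.Computability Literature.Computability.Complexity IsDedekindDomain
open Literature.NumberTheory.EllipticCurves.ModularForms (exists_isNewformOf)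
open Summit.QuantumAdvantage.QuantumAdvantage.Theses.MobiusLadder (LiouvilleNotPPoly)

/-! ### Promise deciders only see the predicate on the promise -/

/-- Two predicates that agree on the promise `t ≥ 1`, `t(27t−1)` squarefree have the same `P/poly`
promise deciders. -/
theorem exists_promiseDecider_congr {S S' : ℕ → Prop}
    (h : ∀ t : ℕ, 1 ≤ t → Squarefree (t * (27 * t - 1)) → (S t ↔ S' t)) :
    (∃ L ∈ PPoly, ∀ t : ℕ, 1 ≤ t → Squarefree (t * (27 * t - 1)) → (encodeNat t ∈ L ↔ S t)) ↔
      (∃ L ∈ PPoly, ∀ t : ℕ, 1 ≤ t → Squarefree (t * (27 * t - 1)) → (encodeNat t ∈ L ↔ S' t)) := by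
  constructor
  · rintro ⟨L, hL, hdec⟩
    exact ⟨L, hL, fun t ht hsq => (hdec t ht hsq).trans (h t ht hsq)⟩
  · rintro ⟨L, hL, hdec⟩
    exact ⟨L, hL, fun t ht hsq => (hdec t ht hsq).trans (h t ht hsq).symm⟩

/-! ### The apex in its three costumes -/

/-- **`AlgRootSignHard ↔ PairHard`, decider form** (unconditional): a `P/poly` language decides
`−∏_p w_p(E_t) = −1` on the promise iff it decides `λ(t)λ(27t−1) = −1` there. -/
theorem algRootSign_promiseDecidable_iff_pairSign :
    (∃ L ∈ PPoly, ∀ t : ℕ, 1 ≤ t → Squarefree (t * (27 * t - 1)) →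
      (encodeNat t ∈ L ↔
        ({ a₁ := 1, a₂ := 0, a₃ := (t : ℚ), a₄ := 0, a₆ := 0 } : WeierstrassCurve ℚ).algebraicRootNumber = -1)) ↔
    (∃ L ∈ PPoly, ∀ t : ℕ, 1 ≤ t → Squarefree (t * (27 * t - 1)) →
      (encodeNat t ∈ L ↔ ArithmeticFunction.liouville t * ArithmeticFunction.liouville (27 * t - 1) = -1)) :=
  exists_promiseDecider_congr fun t ht hsq => by
    rw [(stub_assemble stub_splitAtT stub_multAtShift t ht).2.2.trans (stub_sqfreeSign t ht hsq)]

/-- **`RootSignHard ↔ AlgRootSignHard`, decider form, under the Modularity Theorem**: the analytic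
apex of skeleton v4 and the algebraic apex of v5 have the same deciders, because `E_t` is semistable
(stub F: no additive place, hence squarefree conductor) and the tree's PROVED
`rootNumber_eq_algebraicRootNumber_of_squarefree` then needs only `exists_isNewformOf`. -/
theorem rootSign_promiseDecidable_iff_algRootSign (hmod : exists_isNewformOf) :
    (∃ L ∈ PPoly, ∀ t : ℕ, 1 ≤ t → Squarefree (t * (27 * t - 1)) →
      (encodeNat t ∈ L ↔
        ({ a₁ := 1, a₂ := 0, a₃ := (t : ℚ), a₄ := 0, a₆ := 0 } : WeierstrassCurve ℚ).rootNumber = -1)) ↔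
    (∃ L ∈ PPoly, ∀ t : ℕ, 1 ≤ t → Squarefree (t * (27 * t - 1)) →
      (encodeNat t ∈ L ↔
        ({ a₁ := 1, a₂ := 0, a₃ := (t : ℚ), a₄ := 0, a₆ := 0 } : WeierstrassCurve ℚ).algebraicRootNumber = -1)) :=
  exists_promiseDecider_congr fun t ht hsq => by
    obtain ⟨hell, hadd, halg⟩ := stub_assemble stub_splitAtT stub_multAtShift t ht
    haveI := hell
    -- no additive place ⇒ squarefree conductor (tree: `p² ∣ N_E ↔` additive reduction over `p`)
    have hsqN : Squarefree (({ a₁ := 1, a₂ := 0, a₃ := (t : ℚ), a₄ := 0, a₆ := 0 } : WeierstrassCurve ℚ).conductorNorm ℤ) := by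
      refine Nat.squarefree_iff_prime_squarefree.2 fun p hp h => ?_
      set v : HeightOneSpectrum ℤ := (Rat.HeightOneSpectrum.primesEquiv (R := ℤ)).symm ⟨p, hp⟩ with hv
      have hgen : Rat.HeightOneSpectrum.natGenerator v = p :=
        congrArg Subtype.val ((Rat.HeightOneSpectrum.primesEquiv (R := ℤ)).apply_symm_apply ⟨p, hp⟩)
      refine hadd v ((Literature.NumberTheory.EllipticCurves.natGenerator_sq_dvd_conductorNorm_iff v _).mp ?_)
      rw [hgen, sq]
      exact h
    -- the Modularity Theorem turns the algebraic sign into the analytic one (tree, PROVED for squarefree conductor)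
    rw [WeierstrassCurve.rootNumber_eq_algebraicRootNumber_of_squarefree _ hsqN hmod (fun v hv => absurd hv (hadd v))]

/-- **`PairHard → LiouvilleNotPPoly`**: if no polynomial-size circuit family decides
`λ(t)λ(27t−1) = −1` from `bin t` on the squarefree promise, then `L_λ ∉ P/poly` — a `P/poly`
language for `L_λ` answers `λ = −1` on squarefree inputs, and two queries (`t`, `27t−1`; stub A
with `w := λ·λ(27·−1)`) then decide the pair sign on the promise. The elementary costume of the
apex, as a bridge to the crux BY NAME. -/
theorem liouvilleNotPPoly_of_pairHard : (¬ ∃ L ∈ Literature.Computability.Complexity.PPoly, ∀ t : ℕ, 1 ≤ t → Squarefree (t * (27 * t - 1)) → (Computability.encodeNat t ∈ L ↔ ArithmeticFunction.liouville t * ArithmeticFunction.liouville (27 * t - 1) = -1)) → Summit.QuantumAdvantage.QuantumAdvantage.Theses.MobiusLadder.LiouvilleNotPPoly := by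
  intro hX hmem
  refine hX (stub_transfer (fun t => ArithmeticFunction.liouville t * ArithmeticFunction.liouville (27 * t - 1))
    (fun _ _ _ => rfl) ⟨_, hmem, fun N _ _ => ?_⟩)
  exact encodingNatBool.mem_toLanguage_iff {N : ℕ | ArithmeticFunction.liouville N = -1} N

/-! ### The refutation floor, elementary form -/

/-- **Refutation floor (pair sign, unconditional)**: a refutation of the crux puts
"`λ(t)λ(27t−1) = −1`" (on the squarefree promise) in `P/poly`. -/
theorem pairSign_mem_PPoly_of_not_liouvilleNotPPoly (h : ¬ LiouvilleNotPPoly) :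
    ∃ L ∈ PPoly, ∀ t : ℕ, 1 ≤ t → Squarefree (t * (27 * t - 1)) →
      (encodeNat t ∈ L ↔ ArithmeticFunction.liouville t * ArithmeticFunction.liouville (27 * t - 1) = -1) := by
  by_contra hX
  exact h (liouvilleNotPPoly_of_pairHard hX)

end Summit.QuantumAdvantage.QuantumAdvantage.Theorems.LiouvilleNotPPoly

end
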